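import Literature.NumberTheory.EllipticCurves.ModularSymbolsManinDrinfeldProofs
import Literature.NumberTheory.EllipticCurves.ModularSymbolsManin
import Literature.NumberTheory.EllipticCurves.NewformsLinearIndependenceProofs
import Literature.NumberTheory.Automorphic.LieKolchin
import HarnessLib

/-!
# The Manin–Drinfeld theorem for `Γ₀(N)` (discharge of
# `Literature.NumberTheory.EllipticCurves.ModularForms.exists_nsmul_modularSymbol_mem_periodLattice`)

D-0014 keeps `Literature/` sorry-free by stating cited results as named facts `def X : Prop`.
This sibling file of `ModularSymbols.lean` **discharges** the named fact
`exists_nsmul_modularSymbol_mem_periodLattice f` — the **Manin–Drinfeld theorem** (Manin 1972,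
Cor. 3.6 with the footnote on p. 35; Drinfeld 1973, Thm. 1; Cremona 1997, §2.8): for *every* cusp
form `f ∈ S₂(Γ₀(N))` and every rational cusp `r`, some positive integer multiple of the modular
symbol `{∞, r}_f = 2πi ∫_{i∞}^r f dz` lies in the period lattice `Λ_f` (the periods over closed
paths) — with no hypothesis on `f` (`exists_nsmul_modularSymbol_mem_periodLattice_holds`).
`ModularSymbolsManinDrinfeldProofs` proved it for normalised newforms with rational coefficients
(`exists_nsmul_modularSymbol_mem_periodLattice_of_isNewform0`), where the Hecke eigenvalue `a_p ∈ ℚ`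
can be cleared directly; the general case needs Drinfeld's linear algebra in the dual space. This
file introduces no definitions: the commuting family `(T_p)_{p prime}` and the symbol functionals
`{∞, r}` enter the intermediate statements as parameters `T`, `σ` pinned down by the hypotheses
`hT : T p = heckeT (Gamma0 N) 2 p`, `hσ : σ r h = modularSymbol h r`, instantiated at the end by
`heckeT` and by `inftyFunctional (cuspMatrix r)` of `ModularSymbolsManin`.

## The proof (Manin 1972, Thm. 3.3, 3.5; Drinfeld's remark, footnote 1 on p. 35 of Manin's paper)

Everything happens in the dual space `S₂(Γ₀(N))^∧` (finite-dimensional: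
`finiteDimensional_cuspForm_two`), which contains the **period homology**
`H = {h ↦ {∞, γ∞}_h : γ ∈ Γ₀(N)} = H₁(X₀(N), ℤ)` (`periodHomology N`, finitely generated, Hecke
stable: `dualMap_heckeT_mem_periodHomology`) and the **symbol functionals** `{∞, r} : h ↦ {∞, r}_h`
(Manin's real classes `{i∞, r} ∈ H₁(X₀(N), ℝ) = S₂^∧`, Manin 1972, §1.2).

1. *Closing the path* (Manin (21)–(22), uniformly in `h`): for a prime `p ≡ 1 (mod N)`,
   `T_p^∨ {∞, r} = ∑_{j mod p} {∞, (r + j)/p} + {∞, pr}` (`modularSymbol_heckeT_eq_sum`) and each cusp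
   on the right is `Γ(N)`-equivalent to `r` (Diamond–Shurman Lemma 3.8.2), so by Manin's relation
   `{∞, γr} = {∞, γ∞} + {∞, r}` (`modularSymbol_gamma0_smul_holds`)
   `T_p^∨ {∞, r} - (p + 1) {∞, r} ∈ H` (`dualMap_heckeT_sub_smul_mem_periodHomology`); iterating over
   a list of such primes, `A^∨ {∞, r} ∈ H` for `A = T_{p₁} ⋯ T_{pₘ} - ∏ (pᵢ + 1)`
   (`dualMap_listProd_sub_smul_mem_periodHomology`).
2. *The Hecke factor does not vanish on `S₂(Γ₀(N))`* (Manin, remark after (20): "for large `m` by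
   the growth estimates of the coefficients"): there is such a list with `A` **bijective**
   (`exists_list_bijective_listProd_sub`). Otherwise `ker A`, stable under the commuting `T_q`,
   contains a simultaneous eigenvector `h ≠ 0`, `T_q h = χ(q) h`
   (`Literature.NumberTheory.Automorphic.exists_common_eigenvector_of_commute`), with
   `∏ χ(pᵢ) = ∏ (pᵢ + 1)`; but `(∏ χ(pᵢ)) a_m(h) = a_{m ∏ pᵢ}(h)` for `a_m(h) ≠ 0`
   (`cuspCoeff_listProd_mul`, from `a_n(T_p h) = a_{pn}(h) + …`, `qExpansion_coeff_heckeT_holds`) and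
   Hecke's bound `|a_n| ≤ C n` (`exists_norm_cuspCoeff_le_mul`) give `|∏ χ(pᵢ)| ≤ K_χ ∏ pᵢ`, with
   `K_χ` depending only on the system of eigenvalues `χ`, of which there are finitely many
   (`iSupIndep_iInf_eigenspace`, `finite_ne_bot_iInf_eigenspace`); choosing the primes with
   `∑ 1/pᵢ ≥ max_χ K_χ` — possible as `∑_{p ≡ 1 (N)} 1/p` diverges
   (`exists_finset_prime_modEq_one_le_sum_one_div`, from the prime number theorem for the progression,
   `ModularSymbolsManinDrinfeldProofs`) — gives `∏ (pᵢ + 1) ≥ (1 + ∑ 1/pᵢ) ∏ pᵢ > K_χ ∏ pᵢ`,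
   a contradiction.
3. *Drinfeld's lemma* (`exists_nsmul_mem_of_dualMap_mem`): `A` surjective ⇒ `A^∨` injective; the
   `ℚ`-subspace `W = ℚH + ℚ{∞, r}` of `S₂^∧` is finite-dimensional (`H` is finitely generated,
   `finiteDimensional_span_periodHomology`) and `A^∨ W ⊆ ℚH ⊆ W`, so `A^∨ W = W = ℚH ∋ {∞, r}`:
   clearing denominators, `n {∞, r} ∈ H`, i.e. `n {∞, r}_f = {∞, γ∞}_f` for one `γ ∈ Γ₀(N)` and
   **all** `f` (`exists_nsmul_modularSymbol_eq_cuspSymbol`), whence the named fact.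

## Main statements

* `cuspCoeff_listProd_mul`: `a_{m ∏ p}(h) = (∏ χ(p)) a_m(h)` for a simultaneous eigenvector;
* `iSupIndep_iInf_eigenspace`, `finite_ne_bot_iInf_eigenspace`,
  `exists_norm_listProd_le_of_iInf_eigenspace_ne_bot`: finitely many systems of eigenvalues, each
  with `|∏_{p ∈ l} χ(p)| ≤ K ∏_{p ∈ l} p`;
* `exists_list_bijective_listProd_sub`: **eigenvalue separation**;
* `sub_mem_periodHomology_of_congr`, `dualMap_heckeT_eq_sum`,
  `dualMap_heckeT_sub_smul_mem_periodHomology`, `dualMap_listProd_sub_smul_mem_periodHomology`: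
  **closing the path** in `S₂^∧`;
* `exists_nsmul_mem_of_mem_span_rat`, `exists_nsmul_mem_of_dualMap_mem`: **Drinfeld's lemma**;
* `exists_nsmul_mem_periodHomology` (`n {∞, r} ∈ H₁(X₀(N), ℤ)`),
  `exists_nsmul_modularSymbol_eq_cuspSymbol`, and the discharge
  `exists_nsmul_modularSymbol_mem_periodLattice_holds`.

## References

* Ju. I. Manin, *Parabolic points and zeta functions of modular curves*, Izv. Akad. Nauk SSSR
  Ser. Mat. 36 (1972), 19–66 (Engl. transl. Math. USSR-Izv. 6 (1972), 19–64; lit store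
  `paper:doi-10-1070-im1972v006n01abeh001867`): §1.2, Prop. 1.4, Prop. 3.2, Thm. 3.3 and (20) with
  the remark after it (p. 34), §3.4 (21), Thm. 3.5 and (22), Cor. 3.6 and footnote 1 (p. 35).
* V. G. Drinfeld, *Two theorems on modular curves*, Funct. Anal. Appl. 7 (1973), 155–156, Thm. 1.
* J. E. Cremona, *Algorithms for modular elliptic curves*, 2nd ed. (1997), §2.4, §2.8 (2.8.8),
  §2.9 (2.9.1).
* F. Diamond, J. Shurman, *A first course in modular forms*, GTM 228 (2005), Lemma 3.8.2,
  Prop. 5.2.4, Prop. 5.3.1, Prop. 5.9.1.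
* A. O. L. Atkin, J. Lehner, *Hecke operators on `Γ₀(m)`*, Math. Ann. 185 (1970), Thm. 3.
-/

noncomputable section

open scoped MatrixGroups ModularForm

open CongruenceSubgroup Complex Finset Module

namespace Literature.NumberTheory.EllipticCurves.ModularForms

/-! ### The commuting family `(T_p)_{p prime}` on `S₂(Γ₀(N))`; products over lists of primes -/

section HeckeFamily

variable {N : ℕ} [NeZero N]
  (T : {p : ℕ // p.Prime} → Module.End ℂ (CuspForm (Gamma0 N) 2))
  (hT : ∀ p : {p : ℕ // p.Prime}, T p = (haveI : NeZero (p : ℕ) := ⟨p.2.ne_zero⟩; heckeT (Gamma0 N) 2 p))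

section Commute

include hT

/-- The `T_p`, `p` prime, commute (Diamond–Shurman Prop. 5.2.4; `commute_heckeT_primes`). Here and
below `T` is the family `p ↦ heckeT (Gamma0 N) 2 p` (hypothesis `hT`).
[cite: DiamondShurman2005, Prop. 5.2.4] -/
theorem commute_of_eq_heckeT (p q : {p : ℕ // p.Prime}) : Commute (T p) (T q) := by
  rw [hT, hT]
  exact commute_heckeT_primes p q

/-- Every `T_q` commutes with a product `T_{p₁} ⋯ T_{pₘ}` over a list of primes. [folklore] -/
theorem commute_listProd_of_eq_heckeT (q : {p : ℕ // p.Prime}) (l : List {p : ℕ // p.Prime}) :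
    Commute (T q) (l.map T).prod := by
  refine Commute.list_prod_right _ _ fun x hx ↦ ?_
  obtain ⟨p, -, rfl⟩ := List.mem_map.mp hx
  exact commute_of_eq_heckeT T hT q p

end Commute

omit [NeZero N] in
/-- A simultaneous eigenvector `h` of the `T_p`, `p ∈ l`, with eigenvalues `χ p`, is an eigenvector
of `T_{p₁} ⋯ T_{pₘ}` with eigenvalue `∏ χ(pᵢ)`. [folklore] -/
theorem listProd_apply_of_forall_eq_smul {l : List {p : ℕ // p.Prime}} {h : CuspForm (Gamma0 N) 2}
    {χ : {p : ℕ // p.Prime} → ℂ} (hh : ∀ p ∈ l, T p h = χ p • h) :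
    (l.map T).prod h = (l.map χ).prod • h := by
  induction l with
  | nil => simp
  | cons p l ih =>
    have hl : ∀ q ∈ l, T q h = χ q • h := fun q hq ↦ hh q (List.mem_cons_of_mem p hq)
    rw [List.map_cons, List.prod_cons, Module.End.mul_apply, ih hl, map_smul,
      hh p List.mem_cons_self, smul_smul, List.map_cons, List.prod_cons, mul_comm]

/-! ### Coefficients of simultaneous eigenvectors: `a_{m ∏ p}(h) = (∏ χ(p)) a_m(h)` -/

section Coefficients

include hT

/-- **`a_{pn}(h) = χ(p) a_n(h)` for `p ∤ n`** if `T_p h = χ(p) h` (`p` prime): compare the `n`-th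
coefficients, `a_n(T_p h) = a_{pn}(h) + 𝟙_{p ∤ N} p 𝟙_{p ∣ n} a_{n/p}(h)` (`qExpansion_coeff_heckeT_holds`,
Diamond–Shurman Prop. 5.2.2(a), 5.3.1). [cite: DiamondShurman2005, Prop. 5.3.1] -/
theorem cuspCoeff_prime_mul_of_eq_smul {h : CuspForm (Gamma0 N) 2} (p : {p : ℕ // p.Prime})
    {c : ℂ} (hh : T p h = c • h) {n : ℕ} (hpn : ¬ (p : ℕ) ∣ n) :
    cuspCoeff h (p * n) = c * cuspCoeff h n := by
  haveI : NeZero (p : ℕ) := ⟨p.2.ne_zero⟩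
  have H := qExpansion_coeff_heckeT_holds N 2 h p p.2 n
  rw [hT] at hh
  rw [hh, qExpansion_coeff_smul, if_neg hpn] at H
  simp only [mul_zero, ite_self, add_zero] at H
  rw [cuspCoeff, cuspCoeff, H]

/-- **Multiplicativity along a list of distinct primes**: if `T_p h = χ(p) h` for the primes `p` of a
list `l` without repetition, none of which divides `m`, then `a_{(∏ l) m}(h) = (∏_{p ∈ l} χ(p)) a_m(h)`
(Atkin–Lehner 1970, Thm. 3, for eigenforms; here for an arbitrary simultaneous eigenvector).
[cite: AtkinLehner1970, Thm. 3] -/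
theorem cuspCoeff_listProd_mul {h : CuspForm (Gamma0 N) 2} {χ : {p : ℕ // p.Prime} → ℂ} {l : List {p : ℕ // p.Prime}}
    (hnd : l.Nodup) (hh : ∀ p ∈ l, T p h = χ p • h) {m : ℕ} (hm : ∀ p ∈ l, ¬ (p : ℕ) ∣ m) :
    cuspCoeff h ((l.map (↑)).prod * m) = (l.map χ).prod * cuspCoeff h m := by
  induction l with
  | nil => simp
  | cons p l ih =>
    rw [List.nodup_cons] at hnd
    have hh' : ∀ q ∈ l, T q h = χ q • h := fun q hq ↦ hh q (List.mem_cons_of_mem p hq)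
    have hm' : ∀ q ∈ l, ¬ (q : ℕ) ∣ m := fun q hq ↦ hm q (List.mem_cons_of_mem p hq)
    have hpn : ¬ (p : ℕ) ∣ (l.map (↑)).prod * m := by
      intro hdvd
      rcases (Nat.Prime.dvd_mul p.2).mp hdvd with h1 | h1
      · obtain ⟨a, ha, hpa⟩ := (Prime.dvd_prod_iff p.2.prime).mp h1
        obtain ⟨q, hq, rfl⟩ := List.mem_map.mp ha
        have : (p : ℕ) = q := (Nat.prime_dvd_prime_iff_eq p.2 q.2).mp hpa
        exact hnd.1 (Subtype.ext this ▸ hq)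
      · exact hm p List.mem_cons_self h1
    rw [List.map_cons, List.prod_cons, mul_assoc,
      cuspCoeff_prime_mul_of_eq_smul T hT p (hh p List.mem_cons_self) hpn, ih hnd.2 hh' hm',
      List.map_cons, List.prod_cons, mul_assoc]

end Coefficients

/-! ### Systems of eigenvalues of `(T_p)_p` on `S₂(Γ₀(N))`: finiteness and a growth bound -/

section EigenSystems

include hT

/-- **The joint eigenspaces `⋂_p ker(T_p - χ(p))` for distinct systems of eigenvalues `χ` are
independent** (`iSupIndep_iInf_maxGenEigenspace_heckeT`: already the joint *generalised* eigenspaces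
are independent). [folklore] -/
theorem iSupIndep_iInf_eigenspace :
    iSupIndep fun χ : {p : ℕ // p.Prime} → ℂ ↦ ⨅ p : {p : ℕ // p.Prime}, (T p).eigenspace (χ p) := by
  refine (iSupIndep_iInf_maxGenEigenspace_heckeT (N := N) (k := 2)).mono fun χ ↦ ?_
  refine iInf_mono fun p ↦ ?_
  rw [hT p]
  exact Module.End.eigenspace_le_maxGenEigenspace

/-- Only finitely many systems of eigenvalues `χ` have a nonzero joint eigenspace in the
finite-dimensional space `S₂(Γ₀(N))`. [folklore] -/
theorem finite_ne_bot_iInf_eigenspace :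
    Finite {χ : {p : ℕ // p.Prime} → ℂ // (⨅ p : {p : ℕ // p.Prime}, (T p).eigenspace (χ p)) ≠ ⊥} :=
  haveI := (iSupIndep_iInf_eigenspace T hT).fintypeNeBotOfFiniteDimensional
  Finite.of_fintype _

omit T hT [NeZero N] in
/-- A nonzero cusp form has a nonzero Fourier coefficient `a_m`, `m ≥ 1` (`q`-expansion principle,
`eq_of_forall_cuspCoeff_eq_gamma0`, and `a_0 = 0`). [folklore] -/
theorem exists_cuspCoeff_ne_zero {h : CuspForm (Gamma0 N) 2} (hh : h ≠ 0) :
    ∃ m : ℕ, 0 < m ∧ cuspCoeff h m ≠ 0 := by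
  by_contra hall
  push Not at hall
  apply hh
  refine eq_of_forall_cuspCoeff_eq_gamma0 fun n ↦ ?_
  have h0 : cuspCoeff (0 : CuspForm (Gamma0 N) 2) n = 0 := by
    rw [cuspCoeff, CuspForm.coe_zero, UpperHalfPlane.qExpansion_zero]
    simp
  rw [h0]
  rcases Nat.eq_zero_or_pos n with rfl | hn
  · exact cuspCoeff_zero (one_mem_strictPeriods_gamma0 N) h
  · exact hall n hn

/-- **Growth bound for a system of eigenvalues.** If `χ` is the system of eigenvalues of a nonzero
simultaneous eigenvector `h` of the `T_p` on `S₂(Γ₀(N))`, then there are `m ≥ 1` and `K` with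
`|∏_{p ∈ l} χ(p)| ≤ K ∏_{p ∈ l} p` for every list `l` of distinct primes `p > m`: with `a_m(h) ≠ 0`,
`(∏ χ(p)) a_m(h) = a_{m ∏ p}(h)` (`cuspCoeff_listProd_mul`) is bounded by Hecke's estimate
`|a_n(h)| ≤ C n` (`exists_norm_cuspCoeff_le_mul`, Diamond–Shurman Prop. 5.9.1) — Manin's "growth
estimates of the coefficients" (Manin 1972, Thm. 3.3, remark after (20)).
[cite: Manin1972, Thm. 3.3 (20) and the remark following it] -/
theorem exists_norm_listProd_le_of_iInf_eigenspace_ne_bot {χ : {p : ℕ // p.Prime} → ℂ}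
    (hχ : (⨅ p : {p : ℕ // p.Prime}, (T p).eigenspace (χ p)) ≠ ⊥) :
    ∃ (m : ℕ) (K : ℝ), ∀ l : List {p : ℕ // p.Prime}, (∀ p ∈ l, m < (p : ℕ)) → l.Nodup →
      ‖(l.map χ).prod‖ ≤ K * (((l.map (↑)).prod : ℕ) : ℝ) := by
  obtain ⟨h, hmem, hh0⟩ := (Submodule.ne_bot_iff _).mp hχ
  have heig : ∀ p : {p : ℕ // p.Prime}, T p h = χ p • h := fun p ↦ by
    have := (Submodule.mem_iInf _).mp hmem p
    rwa [Module.End.mem_eigenspace_iff] at this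
  obtain ⟨m, hm0, hm⟩ := exists_cuspCoeff_ne_zero hh0
  obtain ⟨C, hC0, hC⟩ := exists_norm_cuspCoeff_le_mul h
  refine ⟨m, C * m / ‖cuspCoeff h m‖, fun l hl hnd ↦ ?_⟩
  have hnorm : 0 < ‖cuspCoeff h m‖ := norm_pos_iff.mpr hm
  have hdvd : ∀ p ∈ l, ¬ (p : ℕ) ∣ m := fun p hp ↦ Nat.not_dvd_of_pos_of_lt hm0 (hl p hp)
  have hmul := cuspCoeff_listProd_mul T hT hnd (fun p _ ↦ heig p) hdvd
  have hle := hC ((l.map (↑)).prod * m)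
  rw [hmul, norm_mul, Nat.cast_mul] at hle
  rw [div_mul_eq_mul_div, le_div_iff₀ hnorm]
  calc ‖(l.map χ).prod‖ * ‖cuspCoeff h m‖ ≤ C * (((l.map (↑)).prod : ℕ) * (m : ℝ)) := hle
    _ = C * m * (((l.map (↑)).prod : ℕ) : ℝ) := by ring

end EigenSystems

/-! ### A product of Hecke operators avoiding the Eisenstein eigenvalue -/

section Separation

omit T hT [NeZero N] in
/-- `∏_{p ∈ S} (1 + 1/p) ∏_{p ∈ S} p = ∏_{p ∈ S} (p + 1)` for a finite set of positive naturals.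
[folklore] -/
theorem prod_one_add_div_mul_prod (S : Finset ℕ) (hS : ∀ p ∈ S, p ≠ 0) :
    (∏ p ∈ S, (1 + 1 / (p : ℝ))) * ∏ p ∈ S, (p : ℝ) = ∏ p ∈ S, ((p : ℝ) + 1) := by
  rw [← Finset.prod_mul_distrib]
  refine Finset.prod_congr rfl fun p hp ↦ ?_
  have : (p : ℝ) ≠ 0 := by exact_mod_cast hS p hp
  field_simp

include hT

/-- **Eigenvalue separation.** There is a finite list `l` of distinct primes `p ≡ 1 (mod N)`,
`p > N`, such that `T_{p₁} ⋯ T_{pₘ} - ∏ (pᵢ + 1)` is bijective on `S₂(Γ₀(N))`: otherwise its kernel,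
being stable under the commuting family `(T_q)_q`, contains a simultaneous eigenvector `h ≠ 0`
(`Literature.NumberTheory.Automorphic.exists_common_eigenvector_of_commute`) with
`∏ χ(pᵢ) = ∏ (pᵢ + 1)`, contradicting `|∏ χ(pᵢ)| ≤ K ∏ pᵢ < (1 + ∑ 1/pᵢ) ∏ pᵢ ≤ ∏ (pᵢ + 1)` once
`∑_{p ∈ l} 1/p ≥ K` for the finitely many systems of eigenvalues `χ` (`K` uniform;
`exists_norm_listProd_le_of_iInf_eigenspace_ne_bot`), which is possible because `∑_{p ≡ 1 (N)} 1/p`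
diverges (`exists_finset_prime_modEq_one_le_sum_one_div`, from the prime number theorem for the
progression). This is the non-vanishing of Manin's factor `∑_{d ∣ m} d - c_m` (Manin 1972, Thm. 3.3,
(20): "`≠ 0` for sufficiently large `m` by the growth estimates"), arranged for all of `S₂(Γ₀(N))`
at once as in Drinfeld's proof. [cite: Manin1972, Thm. 3.3 (20) and Thm. 3.5] -/
theorem exists_list_bijective_listProd_sub :
    ∃ l : List {p : ℕ // p.Prime}, (∀ p ∈ l, ((p : ℕ) : ZMod N) = 1 ∧ N < (p : ℕ)) ∧ l.Nodup ∧
      Function.Bijective ((l.map T).prod -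
        (((l.map fun p : {p : ℕ // p.Prime} ↦ (p : ℕ) + 1).prod : ℕ) : ℂ) •
          (1 : Module.End ℂ (CuspForm (Gamma0 N) 2))) := by
  -- uniform constants over the finitely many systems of eigenvalues
  set ι₀ := {χ : {p : ℕ // p.Prime} → ℂ // (⨅ p : {p : ℕ // p.Prime}, (T p).eigenspace (χ p)) ≠ ⊥}
  haveI : Finite ι₀ := finite_ne_bot_iInf_eigenspace T hT
  choose m K hmK using fun x : ι₀ ↦ exists_norm_listProd_le_of_iInf_eigenspace_ne_bot T hT x.2
  obtain ⟨P, hP⟩ := (Set.finite_range m).bddAbove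
  obtain ⟨Kmax, hKmax⟩ := (Set.finite_range K).bddAbove
  have hmP : ∀ x, m x ≤ P := fun x ↦ hP ⟨x, rfl⟩
  have hKK : ∀ x, K x ≤ Kmax := fun x ↦ hKmax ⟨x, rfl⟩
  -- primes `p ≡ 1 (N)`, `p > max P N`, with `∑ 1/p ≥ Kmax`
  obtain ⟨S, hS, hB⟩ := exists_finset_prime_modEq_one_le_sum_one_div N Kmax (max P N)
  have hSp : ∀ p ∈ S, p.Prime := fun p hp ↦ (hS p hp).1.1
  set l : List {p : ℕ // p.Prime} := (S.subtype Nat.Prime).toList with hl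
  have hlS : ∀ p : {p : ℕ // p.Prime}, p ∈ l ↔ (p : ℕ) ∈ S := fun p ↦ by
    rw [hl, Finset.mem_toList, Finset.mem_subtype]
  refine ⟨l, fun p hp ↦ ?_, Finset.nodup_toList _, ?_⟩
  · obtain ⟨⟨-, hp1⟩, hlt⟩ := hS p ((hlS p).mp hp)
    exact ⟨hp1, lt_of_le_of_lt (le_max_right _ _) hlt⟩
  set c : ℕ := (l.map fun p : {p : ℕ // p.Prime} ↦ (p : ℕ) + 1).prod with hc
  set A : Module.End ℂ (CuspForm (Gamma0 N) 2) := (l.map T).prod - (c : ℂ) • 1 with hA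
  -- injectivity suffices
  suffices hinj : Function.Injective A from ⟨hinj, LinearMap.injective_iff_surjective.mp hinj⟩
  rw [← LinearMap.ker_eq_bot]
  by_contra hker
  -- the kernel is stable under the `T_q` and they commute: common eigenvector
  have hcommA : ∀ q : {p : ℕ // p.Prime}, Commute (T q) A := fun q ↦
    (commute_listProd_of_eq_heckeT T hT q l).sub_right ((Commute.one_right _).smul_right _)
  obtain ⟨v, hvker, hv0, hv⟩ := Literature.NumberTheory.Automorphic.exists_common_eigenvector_of_commute
    (Set.range T) (LinearMap.ker A) hker
    (by
      rintro _ ⟨q, rfl⟩ w hw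
      rw [LinearMap.mem_ker] at hw ⊢
      rw [← Module.End.mul_apply, ← (hcommA q).eq, Module.End.mul_apply, hw, map_zero])
    (by
      rintro _ ⟨q, rfl⟩ _ ⟨q', rfl⟩ w _
      rw [← Module.End.mul_apply, (commute_of_eq_heckeT T hT q q').eq, Module.End.mul_apply])
  choose χ hχ using fun q : {p : ℕ // p.Prime} ↦ hv _ ⟨q, rfl⟩
  have hvJ : v ∈ ⨅ p : {p : ℕ // p.Prime}, (T p).eigenspace (χ p) :=
    (Submodule.mem_iInf _).mpr fun p ↦ Module.End.mem_eigenspace_iff.mpr (hχ p)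
  have hJ : (⨅ p : {p : ℕ // p.Prime}, (T p).eigenspace (χ p)) ≠ ⊥ := fun h0 ↦ hv0 (by simpa [h0] using hvJ)
  set x₀ : ι₀ := ⟨χ, hJ⟩
  -- `A v = 0` gives `∏ χ(p) = c`
  have hprod : (l.map T).prod v = (l.map χ).prod • v :=
    listProd_apply_of_forall_eq_smul T fun p _ ↦ hχ p
  have hAv : A v = 0 := hvker
  have heq : (l.map χ).prod = (c : ℂ) := by
    rw [hA, LinearMap.sub_apply, hprod, LinearMap.smul_apply, Module.End.one_apply, ← sub_smul,
      smul_eq_zero, sub_eq_zero] at hAv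
    exact hAv.resolve_right hv0
  -- the bound for the system `χ`
  have hbound := hmK x₀ l (fun p hp ↦ lt_of_le_of_lt (hmP x₀)
    (lt_of_le_of_lt (le_max_left _ _) (hS p ((hlS p).mp hp)).2)) (Finset.nodup_toList _)
  rw [heq, Complex.norm_natCast] at hbound
  -- `c = ∏ (p + 1)`, `∏ l = ∏ p`
  have hc' : (c : ℝ) = ∏ p ∈ S, ((p : ℝ) + 1) := by
    have : c = ∏ p ∈ S, (p + 1) := by
      rw [hc, hl, Finset.prod_map_toList,
        Finset.prod_subtype_of_mem (f := fun p : ℕ ↦ p + 1) hSp]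
    rw [this]
    push_cast
    rfl
  have hprodl : (((l.map (↑)).prod : ℕ) : ℝ) = ∏ p ∈ S, (p : ℝ) := by
    have : ((l.map (↑)).prod : ℕ) = ∏ p ∈ S, p := by
      rw [hl, Finset.prod_map_toList, Finset.prod_subtype_of_mem (f := fun p : ℕ ↦ p) hSp]
    rw [this]
    push_cast
    rfl
  rw [hc', hprodl] at hbound
  have hpos : 0 < ∏ p ∈ S, (p : ℝ) :=
    Finset.prod_pos fun p hp ↦ by exact_mod_cast (hSp p hp).pos
  have h1 : ∏ p ∈ S, ((p : ℝ) + 1) ≤ Kmax * ∏ p ∈ S, (p : ℝ) :=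
    hbound.trans (mul_le_mul_of_nonneg_right (hKK x₀) hpos.le)
  have h2 : (1 + ∑ p ∈ S, 1 / (p : ℝ)) * ∏ p ∈ S, (p : ℝ) ≤ ∏ p ∈ S, ((p : ℝ) + 1) := by
    rw [← prod_one_add_div_mul_prod S fun p hp ↦ (hSp p hp).ne_zero]
    exact mul_le_mul_of_nonneg_right (one_add_sum_le_prod_one_add S fun p _ ↦ by positivity)
      hpos.le
  have h3 : Kmax * ∏ p ∈ S, (p : ℝ) < (1 + ∑ p ∈ S, 1 / (p : ℝ)) * ∏ p ∈ S, (p : ℝ) :=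
    mul_lt_mul_of_pos_right (by linarith) hpos
  linarith

end Separation

end HeckeFamily

/-! ### The symbol functionals `h ↦ {∞, r}_h` and the Hecke action on them modulo periods -/

section SymbolFunctional

variable (N : ℕ) [NeZero N]
  (σ : ℚ → Module.Dual ℂ (CuspForm (Gamma0 N) 2))
  (hσ : ∀ (r : ℚ) (h : CuspForm (Gamma0 N) 2), σ r h = modularSymbol h r)

include hσ

/-- `{∞, r + n} = {∞, r}` for `n ∈ ℤ` (`modularSymbol_add_intCast_holds`; Manin 1972, §1.2: the
parabolic element `(1 n; 0 1) ∈ Γ₀(N)`). Here and below `σ r` is the symbol functional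
`h ↦ {∞, r}_h ∈ S₂(Γ₀(N))^∧` (hypothesis `hσ`), Manin's real class `{i∞, r}`.
[cite: Manin1972, §1.2] -/
theorem symbol_add_intCast (r : ℚ) (n : ℤ) : σ (r + n) = σ r := by
  ext h
  rw [hσ, hσ]
  exact modularSymbol_add_intCast_holds h r n

/-- **Congruent cusps have congruent symbol functionals**: for primitive `(a, c) ≡ (a', c') mod N`
with `c, c' ≠ 0`, `{∞, a'/c'} - {∞, a/c}` is a period functional, uniformly in the cusp form:
`a'/c' = γ(a/c)` with `γ ∈ Γ(N) ⊆ Γ₀(N)` (Diamond–Shurman Lemma 3.8.2,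
`Literature.NumberTheory.EllipticCurves.exists_mem_Gamma_vec_eq`) and Manin's relation
`{∞, γ r} = {∞, γ∞} + {∞, r}` (`modularSymbol_gamma0_smul_holds`, Manin 1972, Prop. 1.4, Thm. 1.6).
This is the functional form of
`Literature.NumberTheory.EllipticCurves.modularSymbol_sub_mem_periodLattice_of_congr`.
[cite: DiamondShurman2005, Lemma 3.8.2 (PDF p. 119)] -/
theorem sub_mem_periodHomology_of_congr {a c a' c' : ℤ} (hac : IsCoprime a c)
    (hac' : IsCoprime a' c') (hc0 : c ≠ 0) (hc0' : c' ≠ 0) (ha : (a' : ZMod N) = a)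
    (hc : (c' : ZMod N) = c) :
    σ ((a' : ℚ) / c') - σ ((a : ℚ) / c) ∈ periodHomology N := by
  obtain ⟨γ, hγ, h0, h1⟩ := Literature.NumberTheory.EllipticCurves.exists_mem_Gamma_vec_eq hac hac' ha hc
  have hγ0 : γ ∈ Gamma0 N := by
    rw [Gamma0_mem]
    exact (Gamma_mem.mp hγ).2.2.1
  have hcQ : (c : ℚ) ≠ 0 := by exact_mod_cast hc0
  have hcQ' : (c' : ℚ) ≠ 0 := by exact_mod_cast hc0'
  have hden : ((γ 1 0 : ℤ) : ℚ) * ((a : ℚ) / c) + ((γ 1 1 : ℤ) : ℚ) = (c' : ℚ) / c := by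
    rw [eq_div_iff hcQ, ← h1]
    push_cast
    field_simp
  have hnum : ((γ 0 0 : ℤ) : ℚ) * ((a : ℚ) / c) + ((γ 0 1 : ℤ) : ℚ) = (a' : ℚ) / c := by
    rw [eq_div_iff hcQ, ← h0]
    push_cast
    field_simp
  have hne : ((γ 1 0 : ℤ) : ℚ) * ((a : ℚ) / c) + ((γ 1 1 : ℤ) : ℚ) ≠ 0 := by
    rw [hden]
    exact div_ne_zero hcQ' hcQ
  have hquot : (((γ 0 0 : ℤ) : ℚ) * ((a : ℚ) / c) + ((γ 0 1 : ℤ) : ℚ)) /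
      (((γ 1 0 : ℤ) : ℚ) * ((a : ℚ) / c) + ((γ 1 1 : ℤ) : ℚ)) = (a' : ℚ) / c' := by
    rw [hnum, hden, div_div_div_cancel_right₀ hcQ]
  have key : σ ((a' : ℚ) / c') = periodFunctional N ⟨γ, hγ0⟩ + σ ((a : ℚ) / c) := by
    ext h
    rw [LinearMap.add_apply, hσ, hσ, periodFunctional_apply, ← hquot]
    exact modularSymbol_gamma0_smul_holds h ⟨γ, hγ0⟩ ((a : ℚ) / c) hne
  rw [key, add_sub_cancel_right]
  exact periodFunctional_mem_periodHomology N _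

/-- For a prime `p ≡ 1 mod N` and a cusp `a/c`: `{∞, p · a/c} - {∞, a/c}` is a period functional
(the cusps `pa/c` and `a/c` are `Γ(N)`-equivalent; functional form of
`Literature.NumberTheory.EllipticCurves.modularSymbol_mul_sub_mem_periodLattice`).
[cite: DiamondShurman2005, Lemma 3.8.2 (PDF p. 119)] -/
theorem mul_sub_mem_periodHomology {p : ℕ} (hp : p.Prime) (hp1 : (p : ZMod N) = 1)
    {a c : ℤ} (hac : IsCoprime a c) (hc0 : c ≠ 0) :
    σ ((p : ℚ) * ((a : ℚ) / c)) - σ ((a : ℚ) / c) ∈ periodHomology N := by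
  by_cases hpc : (p : ℤ) ∣ c
  · obtain ⟨c₁, rfl⟩ := hpc
    have hc₁ : c₁ ≠ 0 := right_ne_zero_of_mul hc0
    have hpQ : (p : ℚ) ≠ 0 := by exact_mod_cast hp.ne_zero
    have heq : (p : ℚ) * ((a : ℚ) / ((p : ℤ) * c₁ : ℤ)) = (a : ℚ) / c₁ := by
      push_cast
      field_simp
    rw [heq]
    refine sub_mem_periodHomology_of_congr N σ hσ hac (hac.of_mul_right_right) hc0 hc₁ rfl ?_
    push_cast
    rw [hp1, one_mul]
  · have hpc' : IsCoprime (p : ℤ) c := by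
      rw [Int.isCoprime_iff_gcd_eq_one]
      have : Int.gcd (p : ℤ) c = Nat.gcd p c.natAbs := rfl
      rw [this, ← Nat.coprime_iff_gcd_eq_one, hp.coprime_iff_not_dvd]
      rwa [Int.natCast_dvd] at hpc
    have heq : (p : ℚ) * ((a : ℚ) / c) = (((p : ℤ) * a : ℤ) : ℚ) / c := by
      push_cast
      ring
    rw [heq]
    refine sub_mem_periodHomology_of_congr N σ hσ hac (hpc'.mul_left hac) hc0 hc0 ?_ rfl
    push_cast
    rw [hp1, one_mul]

/-- For a prime `p ≡ 1 mod N` and a cusp `a/c`: `{∞, (a/c)/p} - {∞, a/c}` is a period functional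
(the cusps `a/(pc)` and `a/c` are `Γ(N)`-equivalent; functional form of
`Literature.NumberTheory.EllipticCurves.modularSymbol_div_sub_mem_periodLattice`).
[cite: DiamondShurman2005, Lemma 3.8.2 (PDF p. 119)] -/
theorem div_sub_mem_periodHomology {p : ℕ} (hp : p.Prime) (hp1 : (p : ZMod N) = 1)
    {a c : ℤ} (hac : IsCoprime a c) (hc0 : c ≠ 0) :
    σ ((a : ℚ) / c / p) - σ ((a : ℚ) / c) ∈ periodHomology N := by
  have hpQ : (p : ℚ) ≠ 0 := by exact_mod_cast hp.ne_zero
  by_cases hpa : (p : ℤ) ∣ a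
  · obtain ⟨a₁, rfl⟩ := hpa
    have heq : (((p : ℤ) * a₁ : ℤ) : ℚ) / c / p = (a₁ : ℚ) / c := by
      push_cast
      field_simp
    rw [heq]
    refine sub_mem_periodHomology_of_congr N σ hσ hac (hac.of_mul_left_right) hc0 hc0 ?_ rfl
    push_cast
    rw [hp1, one_mul]
  · have hpa' : IsCoprime a (p : ℤ) := by
      rw [Int.isCoprime_iff_gcd_eq_one, Int.gcd_comm]
      have : Int.gcd (p : ℤ) a = Nat.gcd p a.natAbs := rfl
      rw [this, ← Nat.coprime_iff_gcd_eq_one, hp.coprime_iff_not_dvd]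
      rwa [Int.natCast_dvd] at hpa
    have hpc0 : (p : ℤ) * c ≠ 0 := mul_ne_zero (by exact_mod_cast hp.ne_zero) hc0
    have heq : (a : ℚ) / c / p = (a : ℚ) / ((p : ℤ) * c : ℤ) := by
      push_cast
      rw [div_div, mul_comm]
    rw [heq]
    refine sub_mem_periodHomology_of_congr N σ hσ hac (hpa'.mul_right hac) hc0 hpc0 rfl ?_
    push_cast
    rw [hp1, one_mul]

/-- **The Hecke operators on the symbol functionals** (Cremona 1997, (2.4.1)–(2.4.2);
`modularSymbol_heckeT_eq_sum`): for a prime `p ∤ N`,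
`T_p^∨ {∞, r} = ∑_{j mod p} {∞, (r + j)/p} + {∞, p r}` in `S₂(Γ₀(N))^∧`.
[cite: CremonaAlgorithms1997, §2.4 (2.4.1)–(2.4.2)] -/
theorem dualMap_heckeT_eq_sum {p : ℕ} [NeZero p] (hp : p.Prime) (hpN : ¬ p ∣ N) (r : ℚ) :
    (heckeT (Gamma0 N) 2 p).dualMap (σ r) =
      ∑ j : Fin p, σ ((r + ((j : ℕ) : ℤ)) / p) + σ (p * r) := by
  ext h
  rw [LinearMap.dualMap_apply, hσ, modularSymbol_heckeT_eq_sum p h hp, if_neg hpN,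
    LinearMap.add_apply, LinearMap.sum_apply, hσ]
  simp only [hσ]

/-- **Closing the path** (Manin 1972, Thm. 3.3, (20) and Thm. 3.5, (22); Cremona 1997, (2.8.8),
(2.9.1)), uniformly in the cusp form: for a prime `p ≡ 1 (mod N)`, `p ∤ N`, and every rational `r`,
`T_p^∨ {∞, r} - (p + 1) {∞, r}` lies in the period homology `H₁(X₀(N), ℤ) ⊆ S₂(Γ₀(N))^∧`, since
each of the `p + 1` cusps `(r + j)/p`, `p r` is `Γ(N)`-equivalent to `r`
(`div_sub_mem_periodHomology`, `mul_sub_mem_periodHomology`).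
[cite: Manin1972, Thm. 3.3 (20) and Thm. 3.5 (22)] -/
theorem dualMap_heckeT_sub_smul_mem_periodHomology {p : ℕ} [NeZero p] (hp : p.Prime)
    (hp1 : (p : ZMod N) = 1) (hpN : ¬ p ∣ N) (r : ℚ) :
    (heckeT (Gamma0 N) 2 p).dualMap (σ r) - ((p : ℂ) + 1) • σ r ∈ periodHomology N := by
  -- write `r = a / c` in lowest terms
  suffices key : ∀ (a c : ℤ), IsCoprime a c → c ≠ 0 →
      (heckeT (Gamma0 N) 2 p).dualMap (σ ((a : ℚ) / c)) -
        ((p : ℂ) + 1) • σ ((a : ℚ) / c) ∈ periodHomology N by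
    have hcop : IsCoprime r.num (r.den : ℤ) := by
      rw [Int.isCoprime_iff_gcd_eq_one, Int.gcd, Int.natAbs_natCast]
      exact r.reduced
    have := key r.num r.den hcop (by exact_mod_cast r.den_ne_zero)
    have hr : ((r.num : ℤ) : ℚ) / ((r.den : ℤ) : ℚ) = r := by
      push_cast
      exact Rat.num_div_den r
    rwa [hr] at this
  intro a c hac hc0
  have hcQ : (c : ℚ) ≠ 0 := by exact_mod_cast hc0
  set x : ℚ := (a : ℚ) / c with hx
  have h1 : σ (p * x) - σ x ∈ periodHomology N := mul_sub_mem_periodHomology N σ hσ hp hp1 hac hc0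
  have h2 : ∀ j : Fin p, σ ((x + ((j : ℕ) : ℤ)) / p) - σ x ∈ periodHomology N := by
    intro j
    have hcopj : IsCoprime (a + c * (j : ℕ)) c := hac.add_mul_left_left _
    have hrj : ((a + c * (j : ℕ) : ℤ) : ℚ) / (c : ℚ) = x + ((j : ℕ) : ℤ) := by
      push_cast
      rw [hx]
      field_simp
    have := div_sub_mem_periodHomology N σ hσ hp hp1 hcopj hc0
    rwa [hrj, symbol_add_intCast N σ hσ] at this
  have hmem : (∑ j : Fin p, (σ ((x + ((j : ℕ) : ℤ)) / p) - σ x)) + (σ (p * x) - σ x) ∈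
      periodHomology N :=
    add_mem (sum_mem fun j _ ↦ h2 j) h1
  have heq : (heckeT (Gamma0 N) 2 p).dualMap (σ x) - ((p : ℂ) + 1) • σ x =
      (∑ j : Fin p, (σ ((x + ((j : ℕ) : ℤ)) / p) - σ x)) + (σ (p * x) - σ x) := by
    rw [dualMap_heckeT_eq_sum N σ hσ hp hpN, Finset.sum_sub_distrib, Finset.sum_const,
      Finset.card_univ, Fintype.card_fin, add_smul, one_smul, ← Nat.cast_smul_eq_nsmul ℂ]
    abel
  rw [heq]
  exact hmem

end SymbolFunctional

/-! ### Products of Hecke operators on the symbol functionals -/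

section ListProd

variable {N : ℕ} [NeZero N]
  (T : {p : ℕ // p.Prime} → Module.End ℂ (CuspForm (Gamma0 N) 2))
  (hT : ∀ p : {p : ℕ // p.Prime}, T p = (haveI : NeZero (p : ℕ) := ⟨p.2.ne_zero⟩; heckeT (Gamma0 N) 2 p))

include hT

/-- The transposes of products `T_{p₁} ⋯ T_{pₘ}` preserve the period homology
(`dualMap_heckeT_mem_periodHomology`, Cremona 1997, §2.4). [cite: CremonaAlgorithms1997, §2.4] -/
theorem dualMap_listProd_mem_periodHomology (l : List {p : ℕ // p.Prime})
    {φ : Module.Dual ℂ (CuspForm (Gamma0 N) 2)} (hφ : φ ∈ periodHomology N) :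
    ((l.map T).prod).dualMap φ ∈ periodHomology N := by
  induction l generalizing φ with
  | nil =>
    rw [List.map_nil, List.prod_nil, Module.End.one_eq_id, LinearMap.dualMap_id]
    exact hφ
  | cons p l ih =>
    haveI : NeZero (p : ℕ) := ⟨p.2.ne_zero⟩
    rw [List.map_cons, List.prod_cons, Module.End.mul_eq_comp, ← LinearMap.dualMap_comp_dualMap,
      LinearMap.comp_apply]
    refine ih ?_
    rw [hT]
    exact dualMap_heckeT_mem_periodHomology N p.2 hφ

variable (σ : ℚ → Module.Dual ℂ (CuspForm (Gamma0 N) 2))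
  (hσ : ∀ (r : ℚ) (h : CuspForm (Gamma0 N) 2), σ r h = modularSymbol h r)

include hσ

/-- **Closing the path with a product of Hecke operators**: for a list `l` of primes `p ≡ 1 (mod N)`,
`p > N`, and every rational `r`,
`(T_{p₁} ⋯ T_{pₘ})^∨ {∞, r} - (∏ (pᵢ + 1)) {∞, r} ∈ H₁(X₀(N), ℤ) ⊆ S₂(Γ₀(N))^∧`
(iterate `dualMap_heckeT_sub_smul_mem_periodHomology`, using the Hecke stability of the period
homology). [cite: Manin1972, Thm. 3.5 (22)] -/
theorem dualMap_listProd_sub_smul_mem_periodHomology {l : List {p : ℕ // p.Prime}}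
    (hl : ∀ p ∈ l, ((p : ℕ) : ZMod N) = 1 ∧ N < (p : ℕ)) (r : ℚ) :
    ((l.map T).prod).dualMap (σ r) -
      (((l.map fun p : {p : ℕ // p.Prime} ↦ (p : ℕ) + 1).prod : ℕ) : ℂ) • σ r ∈ periodHomology N := by
  induction l with
  | nil =>
    rw [List.map_nil, List.prod_nil, Module.End.one_eq_id, LinearMap.dualMap_id, LinearMap.id_apply,
      List.map_nil, List.prod_nil, Nat.cast_one, one_smul, sub_self]
    exact zero_mem _
  | cons p l ih =>
    haveI : NeZero (p : ℕ) := ⟨p.2.ne_zero⟩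
    obtain ⟨hp1, hNp⟩ := hl p List.mem_cons_self
    have hpN : ¬ (p : ℕ) ∣ N := fun h ↦ absurd (Nat.le_of_dvd (NeZero.pos N) h) (not_le.mpr hNp)
    have hl' : ∀ q ∈ l, ((q : ℕ) : ZMod N) = 1 ∧ N < (q : ℕ) := fun q hq ↦
      hl q (List.mem_cons_of_mem p hq)
    set θ := σ r with hθ
    set ψ := (heckeT (Gamma0 N) 2 p).dualMap θ - (((p : ℕ) : ℂ) + 1) • θ with hψ
    set ψ' := ((l.map T).prod).dualMap θ -
      (((l.map fun p : {p : ℕ // p.Prime} ↦ (p : ℕ) + 1).prod : ℕ) : ℂ) • θ with hψ'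
    have hψmem : ψ ∈ periodHomology N :=
      dualMap_heckeT_sub_smul_mem_periodHomology N σ hσ p.2 hp1 hpN r
    have hψ'mem : ψ' ∈ periodHomology N := ih hl'
    have key : (((p :: l).map T).prod).dualMap θ -
        ((((p :: l).map fun p : {p : ℕ // p.Prime} ↦ (p : ℕ) + 1).prod : ℕ) : ℂ) • θ =
        ((l.map T).prod).dualMap ψ + (((p : ℕ) + 1 : ℕ) : ℂ) • ψ' := by
      rw [List.map_cons, List.prod_cons, Module.End.mul_eq_comp, ← LinearMap.dualMap_comp_dualMap,
        LinearMap.comp_apply, hT p, hψ, hψ', map_sub, map_smul, smul_sub, smul_smul, List.map_cons,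
        List.prod_cons]
      push_cast
      abel
    rw [key]
    refine add_mem (dualMap_listProd_mem_periodHomology T hT l hψmem) ?_
    rw [Nat.cast_smul_eq_nsmul]
    exact AddSubgroup.nsmul_mem _ hψ'mem _

end ListProd

/-! ### Drinfeld's linear algebra: rational classes from a Hecke operator avoiding an eigenvalue -/

section Drinfeld

/-- **Clearing denominators**: an element of the `ℚ`-span of an additive subgroup `H` of a
`ℚ`-vector space has a positive integer multiple in `H`. [folklore] -/
theorem exists_nsmul_mem_of_mem_span_rat {D : Type*} [AddCommGroup D] [Module ℚ D]
    (H : AddSubgroup D) {x : D} (hx : x ∈ Submodule.span ℚ (H : Set D)) :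
    ∃ n : ℕ, 0 < n ∧ n • x ∈ H := by
  induction hx using Submodule.span_induction with
  | mem x hx => exact ⟨1, one_pos, by simpa using hx⟩
  | zero => exact ⟨1, one_pos, by simp [zero_mem]⟩
  | add x y _ _ hx hy =>
    obtain ⟨n, hn, hnx⟩ := hx
    obtain ⟨m, hm, hmy⟩ := hy
    refine ⟨n * m, Nat.mul_pos hn hm, ?_⟩
    rw [smul_add]
    refine add_mem ?_ ?_
    · rw [mul_comm, mul_smul]
      exact AddSubgroup.nsmul_mem _ hnx _
    · rw [mul_smul]
      exact AddSubgroup.nsmul_mem _ hmy _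
  | smul q x _ hx =>
    obtain ⟨n, hn, hnx⟩ := hx
    refine ⟨n * q.den, Nat.mul_pos hn q.den_pos, ?_⟩
    have h1 : (q.den : ℚ) • (q • x) = (q.num : ℚ) • x := by
      rw [smul_smul, Rat.den_mul_eq_num]
    have h2 : (n * q.den) • (q • x) = q.num • (n • x) := by
      rw [mul_smul, ← Nat.cast_smul_eq_nsmul ℚ q.den, h1, Int.cast_smul_eq_zsmul, smul_comm]
    rw [h2]
    exact AddSubgroup.zsmul_mem _ hnx _

/-- **Drinfeld's lemma** (the linear algebra of Drinfeld 1973 / Manin 1972, §3.5 footnote: "such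
classes even have finite order"). Let `V` be a finite-dimensional complex vector space, `A` a
surjective endomorphism of `V`, `H ⊆ V^∧` an additive subgroup of the dual space with
finite-dimensional `ℚ`-span, stable under the transpose `A^∨`, and `θ ∈ V^∧` a functional with
`A^∨ θ ∈ H`. Then `n θ ∈ H` for some integer `n > 0`: the `ℚ`-subspace `W = ℚH + ℚθ` is mapped by the
injective `A^∨` into `ℚH ⊆ W`, hence onto `W` (finite dimension), so `W = ℚH ∋ θ`. [folklore] -/
theorem exists_nsmul_mem_of_dualMap_mem {V : Type*} [AddCommGroup V] [Module ℂ V]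
    [FiniteDimensional ℂ V] (A : Module.End ℂ V) (hA : Function.Surjective A)
    (H : AddSubgroup (Module.Dual ℂ V))
    [Module.Finite ℚ (Submodule.span ℚ (H : Set (Module.Dual ℂ V)))]
    (hstab : ∀ φ ∈ H, A.dualMap φ ∈ H) {θ : Module.Dual ℂ V} (hθ : A.dualMap θ ∈ H) :
    ∃ n : ℕ, 0 < n ∧ n • θ ∈ H := by
  set Hq : Submodule ℚ (Module.Dual ℂ V) := Submodule.span ℚ (H : Set (Module.Dual ℂ V)) with hHq
  set L : Submodule ℚ (Module.Dual ℂ V) := Submodule.span ℚ {θ} with hL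
  haveI : Module.Finite ℚ L := FiniteDimensional.span_of_finite ℚ (Set.finite_singleton θ)
  set W : Submodule ℚ (Module.Dual ℂ V) := Hq ⊔ L with hW
  set B : Module.Dual ℂ V →ₗ[ℚ] Module.Dual ℂ V := A.dualMap.restrictScalars ℚ with hB
  have hBinj : Function.Injective B := by
    rw [hB, LinearMap.coe_restrictScalars]
    exact LinearMap.dualMap_injective_iff.mpr hA
  -- `B(W) ⊆ ℚH ⊆ W`
  have hBHq : Hq.map B ≤ Hq := by
    rw [hHq, Submodule.map_span_le]
    intro φ hφ
    exact Submodule.subset_span (hstab φ hφ)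
  have hBθ : B θ ∈ Hq := Submodule.subset_span hθ
  have hBW : ∀ w ∈ W, B w ∈ Hq := by
    intro w hw
    obtain ⟨x, hx, y, hy, rfl⟩ := Submodule.mem_sup.mp hw
    obtain ⟨q, rfl⟩ := Submodule.mem_span_singleton.mp hy
    rw [map_add, map_smul]
    exact add_mem (hBHq ⟨x, hx, rfl⟩) (Submodule.smul_mem _ _ hBθ)
  have hHqW : Hq ≤ W := le_sup_left
  -- the restriction of `B` to `W` is injective, hence surjective
  set BW : W →ₗ[ℚ] W := B.restrict (p := W) (q := W) fun w hw ↦ hHqW (hBW w hw) with hBW'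
  have hinj : Function.Injective BW := fun x y hxy ↦
    Subtype.ext (hBinj (congrArg Subtype.val hxy))
  have hsurj : Function.Surjective BW := LinearMap.injective_iff_surjective.mp hinj
  have hθW : θ ∈ W := Submodule.mem_sup_right (Submodule.mem_span_singleton_self θ)
  obtain ⟨w, hw⟩ := hsurj ⟨θ, hθW⟩
  have hθHq : θ ∈ Hq := by
    have : (BW w : Module.Dual ℂ V) = θ := congrArg Subtype.val hw
    rw [← this]
    exact hBW _ w.2
  exact exists_nsmul_mem_of_mem_span_rat H hθHq

end Drinfeld

/-! ### The Manin–Drinfeld theorem for `Γ₀(N)` -/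

section ManinDrinfeld

variable (N : ℕ) [NeZero N]

/-- **The cuspidal classes are rational** (Manin 1972, Thm. 3.5 with the footnote on p. 35 /
Drinfeld 1973, Thm. 1, for `Γ₀(N)`): for every rational cusp `r` there is an integer `n > 0` such
that `n {∞, r}` is an *integral* class, i.e. the functional `h ↦ n {∞, r}_h` lies in the period
homology `H₁(X₀(N), ℤ) ⊆ S₂(Γ₀(N))^∧`. Here `σ r` is any realisation of the symbol functional
`h ↦ {∞, r}_h` (hypothesis `hσ`). Proof: Drinfeld's lemma `exists_nsmul_mem_of_dualMap_mem` for the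
bijective operator `A = T_{p₁} ⋯ T_{pₘ} - ∏ (pᵢ + 1)` of `exists_list_bijective_listProd_sub`, whose
transpose preserves the period homology (`dualMap_listProd_mem_periodHomology`) and maps `{∞, r}`
into it (`dualMap_listProd_sub_smul_mem_periodHomology`, closing the path at the primes
`pᵢ ≡ 1 (mod N)`). [cite: Manin1972, Thm. 3.5 and Cor. 3.6 (footnote 1, p. 35)] -/
theorem exists_nsmul_mem_periodHomology (σ : ℚ → Module.Dual ℂ (CuspForm (Gamma0 N) 2))
    (hσ : ∀ (r : ℚ) (h : CuspForm (Gamma0 N) 2), σ r h = modularSymbol h r) (r : ℚ) :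
    ∃ n : ℕ, 0 < n ∧ n • σ r ∈ periodHomology N := by
  set T : {p : ℕ // p.Prime} → Module.End ℂ (CuspForm (Gamma0 N) 2) := fun p ↦
    (haveI : NeZero (p : ℕ) := ⟨p.2.ne_zero⟩; heckeT (Gamma0 N) 2 p) with hTdef
  have hT : ∀ p : {p : ℕ // p.Prime},
      T p = (haveI : NeZero (p : ℕ) := ⟨p.2.ne_zero⟩; heckeT (Gamma0 N) 2 p) := fun p ↦ rfl
  obtain ⟨l, hl, -, hbij⟩ := exists_list_bijective_listProd_sub T hT
  set c : ℕ := (l.map fun p : {p : ℕ // p.Prime} ↦ (p : ℕ) + 1).prod with hc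
  set A : Module.End ℂ (CuspForm (Gamma0 N) 2) := (l.map T).prod - (c : ℂ) • 1 with hA
  have hAdual : ∀ φ : Module.Dual ℂ (CuspForm (Gamma0 N) 2),
      A.dualMap φ = ((l.map T).prod).dualMap φ - (c : ℂ) • φ := by
    intro φ
    ext h
    simp [hA]
  refine exists_nsmul_mem_of_dualMap_mem A hbij.2 (periodHomology N) (fun φ hφ ↦ ?_) ?_
  · rw [hAdual]
    refine sub_mem (dualMap_listProd_mem_periodHomology T hT l hφ) ?_
    rw [Nat.cast_smul_eq_nsmul]
    exact AddSubgroup.nsmul_mem _ hφ _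
  · rw [hAdual]
    exact dualMap_listProd_sub_smul_mem_periodHomology T hT σ hσ hl r

/-- The functional `inftyFunctional (cuspMatrix r) : h ↦ {∞, δ_r ∞}_h` of `ModularSymbolsManin`
(`δ_r ∈ SL(2, ℤ)` the standard matrix with `δ_r ∞ = r`, `cuspMatrix r`) is the symbol functional
`h ↦ {∞, r}_h`. [folklore] -/
theorem inftyFunctional_cuspMatrix_apply (r : ℚ) (h : CuspForm (Gamma0 N) 2) :
    (inftyFunctional (cuspMatrix r) : Module.Dual ℂ (CuspForm (Gamma0 N) 2)) h =
      modularSymbol h r := by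
  rw [inftyFunctional_apply, inftySymbol, if_neg (cuspMatrix_apply_one_zero_ne_zero r),
    cuspMatrix_div]

/-- A uniform form of the Manin–Drinfeld theorem: for every rational `r` there are `n > 0` and
`γ ∈ Γ₀(N)` with `n {∞, r}_f = {∞, γ∞}_f` for **all** `f ∈ S₂(Γ₀(N))` (the period homology consists
of period functionals, `coe_periodHomology_eq_range`). [cite: Manin1972, Cor. 3.6] -/
theorem exists_nsmul_modularSymbol_eq_cuspSymbol (r : ℚ) :
    ∃ n : ℕ, 0 < n ∧ ∃ γ : Gamma0 N, ∀ f : CuspForm (Gamma0 N) 2,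
      n • modularSymbol f r = cuspSymbol f γ := by
  obtain ⟨n, hn, hmem⟩ := exists_nsmul_mem_periodHomology N
    (fun r ↦ (inftyFunctional (cuspMatrix r) : Module.Dual ℂ (CuspForm (Gamma0 N) 2)))
    (inftyFunctional_cuspMatrix_apply N) r
  have hmem' : n • (inftyFunctional (cuspMatrix r) : Module.Dual ℂ (CuspForm (Gamma0 N) 2)) ∈
      (periodHomology N : Set _) := hmem
  rw [coe_periodHomology_eq_range] at hmem'
  obtain ⟨γ, hγ⟩ := hmem'
  refine ⟨n, hn, γ, fun f ↦ ?_⟩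
  have := LinearMap.congr_fun hγ f
  rw [periodFunctional_apply, LinearMap.smul_apply, inftyFunctional_cuspMatrix_apply] at this
  exact this.symm

variable {N} (f : CuspForm (Gamma0 N) 2)

/-- **The Manin–Drinfeld theorem** (Manin 1972, Cor. 3.6; Drinfeld 1973, Thm. 1; Cremona 1997,
§2.8) — discharge of the named fact `exists_nsmul_modularSymbol_mem_periodLattice` of
`ModularSymbols`, for **every** weight-`2` cusp form `f` on `Γ₀(N)`: every modular symbol `{∞, r}_f`
between cusps has a positive integer multiple in the period lattice `Λ_f`, the group of periods of
`2πi f(z) dz` over closed paths. From the uniform statement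
`exists_nsmul_modularSymbol_eq_cuspSymbol` (`n {∞, r} ∈ H₁(X₀(N), ℤ)`): Manin's closing of the path
with Hecke operators at primes `p ≡ 1 (mod N)` (Thm. 3.3, 3.5), the non-vanishing of the Hecke
factor on all of `S₂(Γ₀(N))` (`exists_list_bijective_listProd_sub`, from Hecke's bound and
`∑_{p ≡ 1 (N)} 1/p = ∞`), and Drinfeld's linear algebra (`exists_nsmul_mem_of_dualMap_mem`).
[cite: Manin1972, Cor. 3.6] -/
theorem exists_nsmul_modularSymbol_mem_periodLattice_holds :
    exists_nsmul_modularSymbol_mem_periodLattice f := by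
  intro r
  obtain ⟨n, hn, γ, hγ⟩ := exists_nsmul_modularSymbol_eq_cuspSymbol N r
  exact ⟨n, hn, (hγ f).symm ▸ cuspSymbol_mem_periodLattice f γ⟩

end ManinDrinfeld

end Literature.NumberTheory.EllipticCurves.ModularForms
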